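import Summits.BirchSwinnertonDyer.BirchSwinnertonDyer.Theorems.EisensteinPrimesBSDpOnCellCStubC3Reoriented
import HarnessLib

/-!
# O9 (X2c, rank one at an Eisenstein `p ‖ N`), line b1 of crux 4 `BSDpOnCellC`: the RE-ORIENTED IMC atoms
# c3♭′ / c3s♭′ AS NAMED PREDICATES — X-slot (strict prime of `X_ac`) at `𝔭̄`, frames at `(ι′, 𝔭)` —
# and their closure BY NAME from the Keller–Yin Theorem-D binder (cell `bsd-eis`, seat `bsd-eis-cgshw`
# g12; RULING L31 (R1), seat c3h MEMO-2 / p481783)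

HONEST FRAMING (cell `bsd-eis`, run/shared/lean/pub/bsd-eis/): two hypothesis-shaped `@[conjecture]`
predicates + theorems; nothing booked; X2 stays CONSTRUCTION-SHAPED; no label or count moves; BSD is not
proved by any of this.

## Why

The registered IMC stub of line b1 (skeleton v8.1, `stub_c3`) is the conjunction of
`X2.NonsplitIMCEqOnTreeInt W p` and `X2.SplitIMCEqOnTreeInt W p`: for every X2c Heegner datum and every
♭-frame `Q` at `(ι′, 𝔭)`, `Ch_Λ(X_ac^∅ STRICT AT 𝔭)·𝓞_{ℂ_p}⟦T⟧ = (Q)`. Seat c3h decided FROM THE TREE'S OWN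
DEFINITIONS (MEMO-2 7e0f0350; RULING L31 (1)) that the `Λ`-adic partner of a frame at `(ι′, 𝔭)` is `X_ac`
STRICT AT THE OTHER PRIME `𝔭̄` (family B: the Keller–Yin / CGLS / BCS / Yan–Zhu binders), the registered
atoms stating the `γ ↦ γ⁻¹`-CONJUGATE main conjecture (class token MISSTATED-ORIENTATION). RULING L31 (2)
endorsed the reshape c3♭′ / c3s♭′ := the statements of p481783's
`Theorems.nonsplitIMCEqIntAtOther_of_thmD_OPEN` / `splitIMCEqIntAtOther_of_thmD_OPEN` minus the binder
`hD`. This file gives those statements NAMES, so that the reshaped stub, the re-threaded b1 roads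
(`Theorems/EisensteinPrimesBSDpOnCellCReoriented*.lean`) and future closers (road H / D′ / Kolyvagin
divisibility, to be typed in the same orientation) cite ONE predicate each:

* `NonsplitIMCEqOnTreeIntOther W p` (c3♭′), `SplitIMCEqOnTreeIntOther W p` (c3s♭′) — bodies VERBATIM the
  conclusions of p481783's two theorems: the binders of the registered atoms + `Odd (discr K)` (KY §0.1)
  + the other prime `𝔭̄ ∋ p`, `𝔭̄ ≠ 𝔭` + `(p)` split (`((p)).primesOver.ncard = 2` = `X11b.SplitsIn K p`);
  conclusion `X11b.R1.IMCEqIntAt W p κ 𝔭̄ γ Q` for frames `Q` at `(ι′, 𝔭)`.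
* `nonsplitIMCEqOnTreeIntOther_of_thmD_OPEN`, `splitIMCEqOnTreeIntOther_of_thmD_OPEN` — each predicate
  holds at EVERY pair given `KellerYin2024.thmD_imcMult_exists_isBDPLFunction_isTorsion_charIdeal_eq_OPEN`
  (Keller–Yin arXiv:2402.12781v2 Thm. D = Thm. 5.1.3, UNREFEREED PREPRINT, printed proof gapped at
  L1754; taken BY NAME as a hypothesis) — i.e. the reshaped stub is CLOSED BY NAME AT THE PRE TIER;
  `forall_nonsplit…` / `forall_split…` in the stub's exact `∀ W p, CellC → sign → …` shape.

What this is NOT: not a proof of Thm. D; not the registered c3♭ / c3s♭ (those are the conjugate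
statements, equal to these only where `Ch_Λ` is `ι`-invariant — unprinted); no convention from print is
invoked (the orientation was decided from `XAc.X_smul_apply`, the tree avatar's Hodge–Tate weight and the
Bloch–Kato shape, c3h MEMO-2 §2).

References: [KellerYin2024] Thm. D = Thm. 5.1.3, §0.1, §5.1 (arXiv:2402.12781v2 L233–L235, L306–L309,
L1725–L1780; PRE); [Castella2018] Def. 2.2, Thm. 3.1 (arXiv:1704.06608 pp. 5, 9); [CastellaHsieh2018]
§3.3 (arXiv:1505.08165 p. 9); [CastellaGrossiLeeSkinner2022] §1.4, Thm. 2.1.1, Conj. 2.1;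
[JetchevSkinnerWan2017] §2.2.3; [BlochKato1990] §3; cell memos c3h MEMO-1/2, RULING L31.
-/

set_option autoImplicit false

noncomputable section

open scoped Classical MatrixGroups ModularForm

open CongruenceSubgroup WeierstrassCurve NumberField IsDedekindDomain Field PowerSeries
  Literature.NumberTheory.EllipticCurves Literature.NumberTheory.EllipticCurves.GreenbergSelmer
  Literature.NumberTheory.EllipticCurves.ModularForms
  Literature.NumberTheory.EllipticCurves.Rank1Residual
  Literature.NumberTheory.EllipticCurves.Rank1Residual.Typed
  Literature.NumberTheory.GaloisRepresentations Literature.NumberTheory.GaloisCohomology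
  Literature.NumberTheory.Automorphic
  Summit.BirchSwinnertonDyer.Rank1Residual.X11b.AcSelmer
  Summit.BirchSwinnertonDyer.Rank1Residual.X11b.Halves
  Summit.BirchSwinnertonDyer.Rank1Residual.X11b

namespace Summit.BirchSwinnertonDyer.Rank1Residual.X2

/-! ### §1 The re-oriented atoms as named predicates -/

section Atoms

variable (W : WeierstrassCurve ℚ) [W.IsElliptic] [W.IsGloballyMinimal] (p : ℕ) [Fact p.Prime]

/-- **c3♭′ — `NonsplitIMCEqOnTreeIntOther W p`: the anticyclotomic IMC at a NON-SPLIT X2c Heegner datum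
over `𝓞_{ℂ_p}`-frames, X-slot AT THE OTHER PRIME.** For every CGLS Heegner datum of a rank-one X2 pair at a
non-split `p` — level `N = N_E`, `K` imaginary quadratic with `d_K < −4` ODD, the classical Heegner
hypothesis for `N`, `L(E^{d_K},1) ≠ 0`, Heegner datum `(Dt, H)` with `p ∤ c` and Heegner point `P` of
infinite order, anticyclotomic `(κ, γ)`, a degree-one `𝔭 ∋ p`, the OTHER prime `𝔭̄ ∋ p` (`𝔭̄ ≠ 𝔭`, `(p)`
split) —, every newform `f` of `E`, every embedding datum `ι′` inducing `𝔭`, and every ♭-frame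
`(Ω_K ≠ 0, ‖Ω_p‖ = 1, Q)` with `X11b.R1.IsBDPLFunctionInt p ι′ 𝔭 κ γ f Ω_K Ω_p Q`:
`Ch_Λ(X_ac^∅(E[p^∞]) STRICT AT 𝔭̄)·𝓞_{ℂ_p}⟦T⟧ = (Q)` (`X11b.R1.IMCEqIntAt W p κ 𝔭̄ γ Q`). = the conclusion of
`Theorems.nonsplitIMCEqIntAtOther_of_thmD_OPEN` (p481783) VERBATIM; differs from the registered
`NonsplitIMCEqOnTreeInt W p` (X-slot at `𝔭`) by the orientation only (RULING L31: the registered atom is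
the `γ ↦ γ⁻¹`-conjugate; THIS is the faithful one). PRINT STATUS: Keller–Yin Thm. D = v2 Thm. 5.1.3
("`Char_Λ(𝔛_f)Λ^ur = (𝓛_f)`", `𝔛_f` relaxed at `v`, strict at `v̄`, `𝓛_f ∈ Λ^ur` interpolating at `v`)
— PREPRINT WITH GAP at L1754. A predicate on `(W, p)`; NEVER a theorem here unconditionally; closed BY
NAME at the PRE tier (§2). [claim: KellerYin2024, status: under-review]
[cite: KellerYin2024, Thm. D = Thm. 5.1.3 and §0.1 (arXiv:2402.12781v2 L233–L235, L306–L309)]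
[cite: Hsieh2014, Thm. 1 and p. 7 (arXiv:1112.1580) (the receptacle `Z̄_p⟦Γ⁻⟧ ⊆ 𝓞_{ℂ_p}⟦T⟧`)] -/
@[conjecture]
def NonsplitIMCEqOnTreeIntOther : Prop :=
  ∀ (N : ℕ) [NeZero N] (K : Type) [Field K] [NumberField K] (Dt : ModularParametrizationData W N)
    (H : HeegnerDatum N (NumberField.discr K)) (ιK : K →+* ℂ) (P : (W.baseChange K).toAffine.Point),
    CellC W p → ¬ W.HasSplitMultiplicativeReductionAtPrime p → W.conductorNorm ℤ = N →
    IsImaginaryQuadratic K → NumberField.discr K < -4 → SatisfiesHeegnerHypothesis N K →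
    (W.quadraticTwist (NumberField.discr K : ℚ)).entireLFunction 1 ≠ 0 →
    WeierstrassCurve.Affine.Point.map ιK.toRatAlgHom P = heegnerPointComplex Dt H →
    ¬ (p : ℤ) ∣ Dt.c → ¬ IsOfFinAddOrder P →
    Odd (NumberField.discr K) →
    ∀ (κ : ZpExtension K p), κ.IsAnticyclotomic →
      ∀ (γ : Field.absoluteGaloisGroup K) [Fact (κ.IsTopGenerator γ)]
        (𝔭 : HeightOneSpectrum (𝓞 K)), ((p : ℕ) : 𝓞 K) ∈ 𝔭.asIdeal →
        𝔭.asIdeal.ramificationIdx (𝓞 ℚ) = 1 → 𝔭.asIdeal.inertiaDeg (𝓞 ℚ) = 1 →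
        ∀ (𝔭bar : HeightOneSpectrum (𝓞 K)), ((p : ℕ) : 𝓞 K) ∈ 𝔭bar.asIdeal → 𝔭bar ≠ 𝔭 →
          ((Ideal.span {(p : ℤ)}).primesOver (𝓞 K)).ncard = 2 →
        ∀ (f : CuspForm (CongruenceSubgroup.Gamma0 N) 2), IsNewformOf W f →
          ∀ (ι' : PadicAlgCl p ≃+* ℂ),
            (∀ (w : InfinitePlace K) (k : 𝓞 K),
              k ∈ 𝔭.asIdeal ↔ ‖ι'.symm (w.embedding (k : K))‖ < 1) →
            ∀ (ΩK : ℂ) (Ωp : ℂ_[p]) (Q : PowerSeries 𝓞_ℂ_[p]), ΩK ≠ 0 → ‖Ωp‖ = 1 →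
              R1.IsBDPLFunctionInt p ι' 𝔭 κ γ f ΩK Ωp Q →
                R1.IMCEqIntAt W p κ 𝔭bar γ Q

/-- **c3s♭′ — `SplitIMCEqOnTreeIntOther W p`: the anticyclotomic IMC at a SPLIT X2c Heegner datum over
`𝓞_{ℂ_p}`-frames, X-slot AT THE OTHER PRIME** — `NonsplitIMCEqOnTreeIntOther` with the sign flipped; =
the conclusion of `Theorems.splitIMCEqIntAtOther_of_thmD_OPEN` (p481783) VERBATIM (Keller–Yin's Thm. D has
no sign hypothesis). PRINT STATUS: PREPRINT WITH GAP (L1754). A predicate on `(W, p)`; NEVER a theorem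
here unconditionally; closed BY NAME at the PRE tier (§2). [claim: KellerYin2024, status: under-review]
[cite: KellerYin2024, Thm. D = Thm. 5.1.3 and §0.1 (arXiv:2402.12781v2 L233–L235, L306–L309), no sign hypothesis] -/
@[conjecture]
def SplitIMCEqOnTreeIntOther : Prop :=
  ∀ (N : ℕ) [NeZero N] (K : Type) [Field K] [NumberField K] (Dt : ModularParametrizationData W N)
    (H : HeegnerDatum N (NumberField.discr K)) (ιK : K →+* ℂ) (P : (W.baseChange K).toAffine.Point),
    CellC W p → W.HasSplitMultiplicativeReductionAtPrime p → W.conductorNorm ℤ = N →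
    IsImaginaryQuadratic K → NumberField.discr K < -4 → SatisfiesHeegnerHypothesis N K →
    (W.quadraticTwist (NumberField.discr K : ℚ)).entireLFunction 1 ≠ 0 →
    WeierstrassCurve.Affine.Point.map ιK.toRatAlgHom P = heegnerPointComplex Dt H →
    ¬ (p : ℤ) ∣ Dt.c → ¬ IsOfFinAddOrder P →
    Odd (NumberField.discr K) →
    ∀ (κ : ZpExtension K p), κ.IsAnticyclotomic →
      ∀ (γ : Field.absoluteGaloisGroup K) [Fact (κ.IsTopGenerator γ)]
        (𝔭 : HeightOneSpectrum (𝓞 K)), ((p : ℕ) : 𝓞 K) ∈ 𝔭.asIdeal →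
        𝔭.asIdeal.ramificationIdx (𝓞 ℚ) = 1 → 𝔭.asIdeal.inertiaDeg (𝓞 ℚ) = 1 →
        ∀ (𝔭bar : HeightOneSpectrum (𝓞 K)), ((p : ℕ) : 𝓞 K) ∈ 𝔭bar.asIdeal → 𝔭bar ≠ 𝔭 →
          ((Ideal.span {(p : ℤ)}).primesOver (𝓞 K)).ncard = 2 →
        ∀ (f : CuspForm (CongruenceSubgroup.Gamma0 N) 2), IsNewformOf W f →
          ∀ (ι' : PadicAlgCl p ≃+* ℂ),
            (∀ (w : InfinitePlace K) (k : 𝓞 K),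
              k ∈ 𝔭.asIdeal ↔ ‖ι'.symm (w.embedding (k : K))‖ < 1) →
            ∀ (ΩK : ℂ) (Ωp : ℂ_[p]) (Q : PowerSeries 𝓞_ℂ_[p]), ΩK ≠ 0 → ‖Ωp‖ = 1 →
              R1.IsBDPLFunctionInt p ι' 𝔭 κ γ f ΩK Ωp Q →
                R1.IMCEqIntAt W p κ 𝔭bar γ Q

end Atoms

/-! ### §2 Closed BY NAME at the PRE tier from the Keller–Yin Theorem-D binder -/

section FromThmD

variable {W : WeierstrassCurve ℚ} [W.IsElliptic] [W.IsGloballyMinimal] {p : ℕ} [Fact p.Prime]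

/-- **c3♭′ from Keller–Yin Thm. D BY NAME** (p481783's `nonsplitIMCEqIntAtOther_of_thmD_OPEN`, restated
on the named predicate). CONDITIONAL on `hD` (PRE, gapped); nothing asserted.
[claim: KellerYin2024, status: under-review] [cite: KellerYin2024, Thm. D = Thm. 5.1.3 (arXiv:2402.12781v2 L306–L309)] -/
theorem nonsplitIMCEqOnTreeIntOther_of_thmD_OPEN
    (hD : KellerYin2024.thmD_imcMult_exists_isBDPLFunction_isTorsion_charIdeal_eq_OPEN) :
    NonsplitIMCEqOnTreeIntOther W p :=
  Summit.BirchSwinnertonDyer.BirchSwinnertonDyer.Theorems.nonsplitIMCEqIntAtOther_of_thmD_OPEN hD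

/-- **c3s♭′ from Keller–Yin Thm. D BY NAME** (p481783's `splitIMCEqIntAtOther_of_thmD_OPEN`).
CONDITIONAL on `hD`; nothing asserted. [claim: KellerYin2024, status: under-review]
[cite: KellerYin2024, Thm. D = Thm. 5.1.3 (arXiv:2402.12781v2 L306–L309), no sign hypothesis] -/
theorem splitIMCEqOnTreeIntOther_of_thmD_OPEN
    (hD : KellerYin2024.thmD_imcMult_exists_isBDPLFunction_isTorsion_charIdeal_eq_OPEN) :
    SplitIMCEqOnTreeIntOther W p :=
  Summit.BirchSwinnertonDyer.BirchSwinnertonDyer.Theorems.splitIMCEqIntAtOther_of_thmD_OPEN hD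

/-- **The reshaped stub's NON-SPLIT conjunct, in its registered `∀ W p` shape, from Thm. D BY NAME.**
CONDITIONAL on `hD`; nothing asserted. [claim: KellerYin2024, status: under-review]
[cite: KellerYin2024, Thm. D = Thm. 5.1.3 (arXiv:2402.12781v2 L306–L309)] -/
theorem forall_nonsplitIMCEqOnTreeIntOther_of_thmD_OPEN
    (hD : KellerYin2024.thmD_imcMult_exists_isBDPLFunction_isTorsion_charIdeal_eq_OPEN) :
    ∀ (W : WeierstrassCurve ℚ) [W.IsElliptic] [W.IsGloballyMinimal] (p : ℕ) [Fact p.Prime],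
      CellC W p → ¬ W.HasSplitMultiplicativeReductionAtPrime p → NonsplitIMCEqOnTreeIntOther W p :=
  fun _ _ _ _ _ _ _ ↦ nonsplitIMCEqOnTreeIntOther_of_thmD_OPEN hD

/-- **The reshaped stub's SPLIT conjunct, in its registered `∀ W p` shape, from Thm. D BY NAME.**
CONDITIONAL on `hD`; nothing asserted. [claim: KellerYin2024, status: under-review]
[cite: KellerYin2024, Thm. D = Thm. 5.1.3 (arXiv:2402.12781v2 L306–L309), no sign hypothesis] -/
theorem forall_splitIMCEqOnTreeIntOther_of_thmD_OPEN
    (hD : KellerYin2024.thmD_imcMult_exists_isBDPLFunction_isTorsion_charIdeal_eq_OPEN) :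
    ∀ (W : WeierstrassCurve ℚ) [W.IsElliptic] [W.IsGloballyMinimal] (p : ℕ) [Fact p.Prime],
      CellC W p → W.HasSplitMultiplicativeReductionAtPrime p → SplitIMCEqOnTreeIntOther W p :=
  fun _ _ _ _ _ _ _ ↦ splitIMCEqOnTreeIntOther_of_thmD_OPEN hD

end FromThmD

end Summit.BirchSwinnertonDyer.Rank1Residual.X2

end
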